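import Literature.Barriers.ABC.IUTDisputedClaim
import Literature.NumberTheory.DiophantineGeometry.AbcWave0
import HarnessLib

/-!
# The disputed explicit IUT inequality: what it would give toward `ABC` (proofs)

Sibling proof file of `IUTDisputedClaim.lean` (D-0014, barrier audit D-0021 of 2026-08-14); no new
definitions, no judgement on the dispute. Everything here is an elementary IMPLICATION whose
hypothesis is the contested declaration `IUTDisputedClaim` (Theorem B of Mochizuki–Fesenko–Hoshi–
Minamide–Porowski, *Explicit estimates in inter-universal Teichmüller theory*, Kodai Math. J. 45
(2022), Introduction [claim: MochizukiEtAl2022, status: disputed]); the implications are theorems,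
the hypothesis stays a disputed claim (D-0012).

## What the source prints (verified on the page)

Introduction, **Theorem A** (= Theorem 5.3), for a mono-complex number field `L` (`ℚ` or imaginary
quadratic), `d = [L : ℚ]`, nonzero `a + b + c = 0` in `L`, `0 < ε ≤ 1`, with
`H_L(a,b,c) = ∏_v max{|a|_v, |b|_v, |c|_v}`, `rad_L(a,b,c) = ∏_{v ∈ I_L(a,b,c)} #(O_L/p_v)`
(`I_L` = the finite places where `|a|_v, |b|_v, |c|_v` are not all equal), `Δ_L = |disc(L)|`,
`h_1(ε) = 3.4 · 10^30 · ε^{-166/81}`: "(ii) We have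
`H_L(a,b,c) ≤ 2^{5d/2} · max{exp(d/4 · h_d(ε)), (Δ_L · rad_L(a,b,c))^{3(1+ε)/2}}`."
**Theorem B** (= Theorem 5.4) is the declaration `IUTDisputedClaim`:
`|abc| ≤ 2^4 · max{exp(1.7 · 10^30 · ε^{-166/81}), rad(abc)^{3(1+ε)}}` for nonzero coprime integers
`a + b + c = 0`. [claim: MochizukiEtAl2022, status: disputed]

At `L = ℚ`, on the primitive (coprime) integer representative of `(a : b : c)`, one has `d = 1`,
`Δ_ℚ = 1`, `H_ℚ(a,b,c) = max{|a|,|b|,|c|}` (at every prime one of `a, b, c` is a unit) and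
`rad_ℚ(a,b,c) = rad(abc)` (a prime divides at most one of them), so Theorem A (ii) reads
`max{|a|,|b|,|c|} ≤ 2^{5/2} · max{exp(¼ · 3.4 · 10^30 · ε^{-166/81}), rad(abc)^{3(1+ε)/2}}`.

## What is proved

* `max_abs_sq_le_two_mul_abs_prod`: for nonzero integers `a + b + c = 0`,
  `max{|a|,|b|,|c|}² ≤ 2|abc|` (the largest is at most the sum of the other two, each `≥ 1`).
* `IUTDisputedClaim.max_abs_le_thmA`: `IUTDisputedClaim` ⟹ the displayed `L = ℚ` case of
  Theorem A (ii) — square-root of `max² ≤ 2|abc| ≤ 2^5 · max{…}`, using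
  `exp(¼ · 3.4·10^30 · t)² = exp(1.7·10^30 · t)`, `(r^{s/2})² = r^s`, `(2^{5/2})² = 32`.
* `IUTDisputedClaim.abc_le_rad_rpow`: the same in the vocabulary of the summit — for every abc
  triple (`Literature.NumberTheory.DiophantineGeometry.IsABCTriple a b c`, radical `rad a b c`
  computed in `ℕ`) and every `0 < ε ≤ 1`,
  `c ≤ 2^{5/2} · max{exp(¼ · 3.4·10^30 · ε^{-166/81}), (rad a b c)^{(3/2)(1+ε)}}`.

## Consequence for the catalogue

The exponent of the radical that the disputed EXPLICIT inequality delivers for `c` is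
`(3/2)(1+ε) ≥ 3/2`; the summit `ABC` (`Summits/ABC/ABC/Statement.lean`, Bombieri–Gubler
Conj. 12.2.2) asks for `1 + ε` with every `ε > 0`. So a route that imported Theorem B (or Theorem A,
or the constant-`400` sharpening of Zhou, arXiv:2503.14510 [claim: ZhouIUT2025a, status: disputed],
which keeps the exponent `3 + 3ε` on `|abc|`) as a hypothesis would still not reach the summit
sentence by this route; within the IUT corpus only the ineffective [IUTchIV] Corollary 2.3
[claim: Mochizuki2012, status: disputed] has summit strength (via the uniform bounded-degree
reduction of [cite: MochizukiGenEll2010, Thm 2.1]). This quantifies `scope_caveats` (e) of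
`Literature.Barriers.ABC.IUTDisputedClaim`; it neither uses nor asserts any disputed statement.
-/

noncomputable section

open UniqueFactorizationMonoid Literature.NumberTheory.DiophantineGeometry

namespace Literature.Barriers.ABC

/-- For nonzero integers with `a + b + c = 0`, `|c|² ≤ 2·|abc|`: indeed `|c| ≤ |a| + |b| ≤ 2|a||b|`
as `|a|, |b| ≥ 1`. [folklore] -/
theorem abs_sq_le_two_mul_abs_prod {a b c : ℤ} (ha : a ≠ 0) (hb : b ≠ 0)
    (h : a + b + c = 0) : |c| ^ 2 ≤ 2 * |a * b * c| := by
  have ha1 : 1 ≤ |a| := Int.one_le_abs ha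
  have hb1 : 1 ≤ |b| := Int.one_le_abs hb
  have hc' : |c| ≤ |a| + |b| := by
    have : c = -(a + b) := by linarith
    rw [this, abs_neg]
    exact abs_add_le a b
  rw [abs_mul, abs_mul]
  have hab : |a| + |b| ≤ 2 * (|a| * |b|) := by nlinarith
  have hc0 : 0 ≤ |c| := abs_nonneg c
  calc |c| ^ 2 = |c| * |c| := sq |c|
    _ ≤ (2 * (|a| * |b|)) * |c| := by
        exact mul_le_mul_of_nonneg_right (hc'.trans hab) hc0
    _ = 2 * (|a| * |b| * |c|) := by ring

/-- Symmetric form: for nonzero integers with `a + b + c = 0`,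
`max(|a|, |b|, |c|)² ≤ 2·|abc|`. [folklore] -/
theorem max_abs_sq_le_two_mul_abs_prod {a b c : ℤ} (ha : a ≠ 0) (hb : b ≠ 0) (hc : c ≠ 0)
    (h : a + b + c = 0) : (max (max |a| |b|) |c|) ^ 2 ≤ 2 * |a * b * c| := by
  rcases max_cases (max |a| |b|) |c| with ⟨h1, -⟩ | ⟨h1, -⟩ <;> rw [h1]
  · rcases max_cases |a| |b| with ⟨h2, -⟩ | ⟨h2, -⟩ <;> rw [h2]
    · have := abs_sq_le_two_mul_abs_prod hb hc (show b + c + a = 0 by linarith)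
      calc |a| ^ 2 ≤ 2 * |b * c * a| := this
        _ = 2 * |a * b * c| := by ring_nf
    · have := abs_sq_le_two_mul_abs_prod hc ha (show c + a + b = 0 by linarith)
      calc |b| ^ 2 ≤ 2 * |c * a * b| := this
        _ = 2 * |a * b * c| := by ring_nf
  · exact abs_sq_le_two_mul_abs_prod ha hb h

/-- Rewriting the constants: `exp(¼ · 3.4·10³⁰ · t)² = exp(1.7·10³⁰ · t)`. [folklore] -/
theorem exp_quarter_sq (t : ℝ) :
    Real.exp (1 / 4 * (3.4e30 * t)) ^ 2 = Real.exp (1.7e30 * t) := by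
  rw [← Real.exp_nat_mul]
  congr 1
  push_cast
  ring

/-- `(2^{5/2})² = 32` for the real power. [folklore] -/
theorem two_rpow_five_halves_sq : ((2 : ℝ) ^ ((5 : ℝ) / 2)) ^ 2 = 32 := by
  rw [← Real.rpow_natCast, ← Real.rpow_mul (by norm_num : (0 : ℝ) ≤ 2)]
  norm_num

/-- `(r^{s/2})² = r^s` for `r ≥ 0` (real powers). [folklore] -/
theorem rpow_half_sq {r : ℝ} (hr : 0 ≤ r) (s : ℝ) : (r ^ (s / 2)) ^ 2 = r ^ s := by
  rw [← Real.rpow_natCast, ← Real.rpow_mul hr]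
  congr 1
  push_cast
  ring

/-- **Theorem B ⟹ Theorem A (ii) over `ℚ`.** If the disputed explicit inequality `IUTDisputedClaim`
(Theorem B of [ExpEst]) holds, then for nonzero coprime integers `a + b + c = 0` and `0 < ε ≤ 1`,
`max(|a|, |b|, |c|) ≤ 2^{5/2} · max{exp(¼ · 3.4·10³⁰ · ε^{-166/81}), rad(abc)^{3(1+ε)/2}}`,
which is Theorem A (ii) of Mochizuki–Fesenko–Hoshi–Minamide–Porowski read at `L = ℚ`
(`d = 1`, `Δ_ℚ = 1`, `h₁(ε) = 3.4·10³⁰ · ε^{-166/81}`, `H_ℚ(a,b,c) = max(|a|,|b|,|c|)` and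
`rad_ℚ(a,b,c) = rad(abc)` for a primitive integer representative) — Introduction, Theorem A (ii):
"`H_L(a,b,c) ≤ 2^{5d/2} · max{exp(d/4 · h_d(ε)), (Δ_L · rad_L(a,b,c))^{3(1+ε)/2}}`"
[claim: MochizukiEtAl2022, status: disputed]. The implication itself is elementary
(`max(|a|,|b|,|c|)² ≤ 2|abc|`, then take square roots); it records that, over `ℚ`, Theorem A (ii)
is downstream of Theorem B and that the exponent of the radical in the resulting bound for
`c = max` is `(3/2)(1+ε)`, not the `1+ε` of the summit `ABC`. [folklore] -/
theorem IUTDisputedClaim.max_abs_le_thmA (H : IUTDisputedClaim) {a b c : ℤ} (ha : a ≠ 0)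
    (hb : b ≠ 0) (hc : c ≠ 0) (hg : Int.gcd a b = 1) (h : a + b + c = 0) {ε : ℝ} (hε : 0 < ε)
    (hε1 : ε ≤ 1) :
    (max (max |a| |b|) |c| : ℝ) ≤
      2 ^ ((5 : ℝ) / 2) * max (Real.exp (1 / 4 * (3.4e30 * ε ^ (-(166 : ℝ) / 81))))
        (((radical (a * b * c) : ℤ) : ℝ) ^ (3 * (1 + ε) / 2)) := by
  -- Theorem B (before fixing notation, so that `set` rewrites it too)
  have hB := H a b c ha hb hc hg h ε hε hε1
  -- notation
  set t : ℝ := ε ^ (-(166 : ℝ) / 81) with ht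
  set r : ℝ := ((radical (a * b * c) : ℤ) : ℝ) with hr
  set M : ℝ := (max (max |a| |b|) |c| : ℝ) with hM
  set E' : ℝ := Real.exp (1 / 4 * (3.4e30 * t)) with hE'
  set R' : ℝ := r ^ (3 * (1 + ε) / 2) with hR'
  set C : ℝ := (2 : ℝ) ^ ((5 : ℝ) / 2) with hC
  have hr0 : 0 ≤ r := by
    rw [hr]; exact_mod_cast (Int.radical_pos _).le
  have hC0 : 0 ≤ C := by rw [hC]; positivity
  have hE'0 : 0 ≤ E' := (Real.exp_pos _).le
  have hR'0 : 0 ≤ R' := by rw [hR']; exact Real.rpow_nonneg hr0 _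
  have hM0 : 0 ≤ M := by rw [hM]; exact le_trans (abs_nonneg _) (le_max_right _ _)
  -- the elementary square bound
  have hsq : M ^ 2 ≤ 2 * (|a * b * c| : ℝ) := by
    have := max_abs_sq_le_two_mul_abs_prod ha hb hc h
    have : (((max (max |a| |b|) |c|) ^ 2 : ℤ) : ℝ) ≤ ((2 * |a * b * c| : ℤ) : ℝ) := by
      exact_mod_cast this
    push_cast at this
    simpa [hM] using this
  have hsq' : M ^ 2 ≤ 32 * max (Real.exp (1.7e30 * t)) (r ^ (3 * (1 + ε))) := by
    have := mul_le_mul_of_nonneg_left hB (by norm_num : (0 : ℝ) ≤ 2)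
    linarith
  -- rewrite the right-hand side as a square
  have hE : Real.exp (1.7e30 * t) = E' ^ 2 := (exp_quarter_sq t).symm
  have hR : r ^ (3 * (1 + ε)) = R' ^ 2 := by
    rw [hR', ← rpow_half_sq hr0 (3 * (1 + ε))]
  have h32 : (32 : ℝ) = C ^ 2 := two_rpow_five_halves_sq.symm
  rw [hE, hR, h32] at hsq'
  -- conclude by comparing squares
  have key : M ^ 2 ≤ (C * max E' R') ^ 2 := by
    rcases le_total (E' ^ 2) (R' ^ 2) with hle | hle
    · rw [max_eq_right hle] at hsq'
      calc M ^ 2 ≤ C ^ 2 * R' ^ 2 := hsq'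
        _ = (C * R') ^ 2 := by ring
        _ ≤ (C * max E' R') ^ 2 := by
            gcongr
            exact le_max_right _ _
    · rw [max_eq_left hle] at hsq'
      calc M ^ 2 ≤ C ^ 2 * E' ^ 2 := hsq'
        _ = (C * E') ^ 2 := by ring
        _ ≤ (C * max E' R') ^ 2 := by
            gcongr
            exact le_max_left _ _
  exact le_of_pow_le_pow_left₀ two_ne_zero (mul_nonneg hC0 (le_max_of_le_left hE'0)) key

/-- **What the disputed claim would give toward the summit `ABC`.** Assuming `IUTDisputedClaim`
(Theorem B of [ExpEst] [claim: MochizukiEtAl2022, status: disputed]), every abc triple — coprime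
positive naturals `a + b = c` (`IsABCTriple`) — satisfies, for every `0 < ε ≤ 1`,
`c ≤ 2^{5/2} · max{exp(¼ · 3.4·10³⁰ · ε^{-166/81}), rad(abc)^{(3/2)(1+ε)}}`
with `rad` the radical computed in `ℕ` (`Literature.NumberTheory.DiophantineGeometry.rad`). The
exponent of the radical is `(3/2)(1+ε) ≥ 3/2`, whereas the summit `ABC`
(`Summits/ABC/ABC/Statement.lean`) asks for `1 + ε` with every `ε > 0`: importing the disputed
explicit inequality, even as a hypothesis, does not yield the summit sentence by this route; the
summit-strength claim in the IUT corpus is the ineffective [IUTchIV] Corollary 2.3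
[claim: Mochizuki2012, status: disputed]. Proof: apply `IUTDisputedClaim.max_abs_le_thmA` to the
integer triple `(a, b, -c)`. [folklore] -/
theorem IUTDisputedClaim.abc_le_rad_rpow (H : IUTDisputedClaim) {ε : ℝ} (hε : 0 < ε) (hε1 : ε ≤ 1)
    {a b c : ℕ} (ht : IsABCTriple a b c) :
    (c : ℝ) ≤ 2 ^ ((5 : ℝ) / 2) * max (Real.exp (1 / 4 * (3.4e30 * ε ^ (-(166 : ℝ) / 81))))
      ((rad a b c : ℝ) ^ (3 * (1 + ε) / 2)) := by
  obtain ⟨ha, hb, habc, hcop⟩ := ht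
  have hc : 0 < c := by omega
  have ha' : (a : ℤ) ≠ 0 := by exact_mod_cast ha.ne'
  have hb' : (b : ℤ) ≠ 0 := by exact_mod_cast hb.ne'
  have hc' : (-(c : ℤ)) ≠ 0 := by rw [neg_ne_zero]; exact_mod_cast hc.ne'
  have hg : Int.gcd (a : ℤ) (b : ℤ) = 1 := by rw [Int.gcd_natCast_natCast]; exact hcop
  have hsum : (a : ℤ) + (b : ℤ) + (-(c : ℤ)) = 0 := by rw [← habc]; push_cast; ring
  have key := H.max_abs_le_thmA ha' hb' hc' hg hsum hε hε1
  have hprod : (a : ℤ) * (b : ℤ) * (-(c : ℤ)) = -((a * b * c : ℕ) : ℤ) := by push_cast; ring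
  have hrad : ((radical ((a : ℤ) * (b : ℤ) * (-(c : ℤ))) : ℤ) : ℝ) = (rad a b c : ℝ) := by
    rw [hprod, UniqueFactorizationDomain.radical_neg, Int.radical_natCast, rad_def]
    push_cast
    rfl
  rw [hrad] at key
  refine le_trans ?_ key
  have : ((-(c : ℤ) : ℤ) : ℝ) = -(c : ℝ) := by push_cast; ring
  rw [this, abs_neg, Nat.abs_cast]
  exact le_max_right _ _

end Literature.Barriers.ABC

end
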